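import Literature.NumberTheory.PAdicHodge.BmaxPlusLogSumThetaValue
import Literature.NumberTheory.PAdicHodge.AinfFrobeniusDivisionLift
import Literature.NumberTheory.PAdicHodge.BmaxPlusFormalLogThetaFrobenius
import HarnessLib

/-!
# `θ(f φΛ_N(ι[ũ], z)) = p^N · 𝒞_u(log_W(Xᵖ))`: the θ-value of the Frobenius partner of an `A_max`-period is `p^N` times the COLMEZ FUNCTIONAL
# of `log_W(Xᵖ)` along the tower (equivalently `p^N·log_W(v₀)` for the Frobenius-twisted tower `v`)

Topic `Literature/NumberTheory/PAdicHodge`; namespace `Literature.NumberTheory.PAdicHodge.AinfTop`. THEOREMS ONLY (no definition, no named fact, no instance,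
no `sorry`). Sequel of `BmaxPlusLogSumThetaValue` (T2a: `θ(f Λ_N(ι y₀, z)) = p^N·Σ'[Xʲ]log_W·θ(y₀)ʲ`), `AinfFrobeniusDivisionLift` (`θ(φ[ũ]) = v₀`, `v` the exact
`[p]_W`-tower with `‖vₙ − uₙᵖ‖ ≤ ‖p‖`) and `SecondKindColmezFunctional{,Transport,HodgeLine}` (J2–J4). Setting: `F` a `p`-adic field, `W/ℤ`, `u` an exact
`[p]_W`-division tower of `Ŵ(𝔪_{ℂ_F})`, `[ũ]` its canonical lift, `Λ = Λ_N(ι[ũ], z) ∈ A_max` its period (`ι[ũ]^N = p·z`), `φ = frobBmaxPlus`, `f = bmaxPlusToBdR`,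
`ℓ = log_W ∈ ℂ_F⟦X⟧`, `ℓ^{(p)} = expand_p ℓ = ℓ(Xᵖ)`, values `G(x) = Σ' [Xʲ]G·xʲ`.

* §1 `tsum_coeff_expand_mul_pow` — **`ℓ^{(p)}(x) = ℓ(xᵖ)`** as series values (reindexing `j = p·i`).
* §2 `tsum_formalLog_frobTwist_eq_of_tendsto` — for the Frobenius-twisted tower `v` (exact, `‖vₙ − uₙᵖ‖ ≤ ‖p‖`) and `𝒞 = lim pᵐ·ℓ^{(p)}(u_m)`: **`ℓ(v₀) = 𝒞`**
  (transport invariance J3 for `ℓ` — cocycle `0`, so `pᵐℓ(v_m) = ℓ(v₀)` — along `v` versus the `‖p‖`-close sequence `(uₘᵖ)`, and §1).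
* §3 ★★ `thetaBdR_bmaxPlusToBdR_frobBmaxPlus_logSum_eq_pow_mul_tsum` — **`θ_dR(f(φΛ_N(ι[ũ], z))) = p^N·ℓ(v₀)`** (`φΛ_N(ι[ũ], z) = Λ_N(ι φ[ũ], φ⁰z)`,
  `frobBmaxPlus_logSum_algebraMap`; T2a at `y₀ = φ[ũ]`; `θ(φ[ũ]) = v₀`); ★★★ `thetaBdR_bmaxPlusToBdR_frobBmaxPlus_logSum_eq_pow_mul_colmez` —
  **`θ_dR(f(φΛ)) = p^N · 𝒞`** for the Colmez functional `𝒞 = lim pᵐ·ℓ^{(p)}(u_m)` (T2b).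

Purpose (crux K★ `stmt-BirchSwinnertonDyer-22226`, line `kato_lever`, memo `Lines/kato-lever-K2-ramified-cm-transport.md` §9, step T2): with T2a (`θ(fΛ_w) = p^N·ℓ(w₀)`,
p770210) and (HL-eval) (`log_{W_D}(u₀) = A·ℓ(w₀) + B·𝒞_w(ℓ^{(p)})`, p769861/p770176) this gives `θ(f(A·Λ_w + B·φΛ_w)) = p^N·log_{W_D}(u₀)` for the CM-fibre
transport `w = Tu` of a K★ cell's tower — the `Fil¹`/θ-value input of the socket for the transported crystalline pair. Infrastructure only; BSD / K★ are not proved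
by any of this.

## References
* P. Colmez, *Périodes p-adiques des variétés abéliennes*, Math. Ann. 292 (1992), §2 (the period functional and its Frobenius). [Colmez1992PeriodesAbeliennes]
* N. M. Katz, *Crystalline cohomology, Dieudonné modules, and Jacobi sums* (1981), §5.1, Thm. 5.1.4 (`F(f) = f(Xᵖ)` on `D(G/R)`). [Katz1981CrystallineDieudonne]
* J.-M. Fontaine, *Formes différentielles et modules de Tate…*, Invent. Math. 65 (1982), §5. [Fontaine1982FormesDifferentielles]
-/

noncomputable section

open Ideal WittVector ValuativeRel Field Filter Finset
open scoped Topology Classical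

namespace Literature.NumberTheory.PAdicHodge

namespace AinfTop

open Literature.NumberTheory.GaloisRepresentations Literature.NumberTheory.GaloisRepresentations.IsNonarchimedeanLocalField
open Literature.NumberTheory.GaloisRepresentations.LubinTate Literature.NumberTheory.EllipticCurves
open Literature.RingTheory.FormalGroups Literature.AlgebraicGeometry.Resolution GaloisContinuity

/-! ## §1 Values of `expand`: `ℓ^{(p)}(x) = ℓ(xᵖ)` -/

section Expand

variable {K : Type*} [NormedField K] {p : ℕ} [hp : Fact p.Prime]

/-- **`Σ' [Xʲ]G^{(p)}·xʲ = Σ' [Xⁱ]G·(xᵖ)ⁱ`** (`G^{(p)} = expand_p G`; the left series is supported on `j = p·i`). [cite: Katz1981CrystallineDieudonne, Thm. 5.1.4] -/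
theorem tsum_coeff_expand_mul_pow (G : PowerSeries K) (x : K) :
    ∑' j : ℕ, PowerSeries.coeff j (PowerSeries.expand p hp.out.ne_zero G) * x ^ j = ∑' i : ℕ, PowerSeries.coeff i G * (x ^ p) ^ i := by
  have hinj : Function.Injective (fun i : ℕ => p * i) := fun a b h => Nat.eq_of_mul_eq_mul_left hp.out.pos h
  have hsupp : Function.support (fun j : ℕ => PowerSeries.coeff j (PowerSeries.expand p hp.out.ne_zero G) * x ^ j) ⊆
      Set.range (fun i : ℕ => p * i) := by
    intro j hj
    rw [Function.mem_support] at hj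
    by_contra hrange
    apply hj
    rw [PowerSeries.coeff_expand_of_not_dvd p hp.out.ne_zero G (fun ⟨i, hi⟩ => hrange ⟨i, hi.symm⟩), zero_mul]
  rw [← hinj.tsum_eq hsupp]
  refine tsum_congr fun i => ?_
  rw [PowerSeries.coeff_expand_mul, pow_mul]

end Expand

variable {F : Type} [Field F] [ValuativeRel F] [TopologicalSpace F] [IsNonarchimedeanLocalField F]
  [CharZero F] {p : ℕ} [Fact p.Prime] [Fact (¬ IsUnit (p : integerC F))]
  [IsAdicComplete (Ideal.span {(p : integerC F)}) (integerC F)]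
  {hθ : Function.Surjective (fontaineTheta (integerC F) p)} (W : WeierstrassCurve ℤ)

/-! ## §2 `ℓ(v₀) = 𝒞_u(ℓ^{(p)})` for the Frobenius-twisted tower `v` -/

omit [IsAdicComplete (Ideal.span {(p : integerC F)}) (integerC F)] [CharZero F] in
/-- ★ **`ℓ(v₀) = lim pᵐ·ℓ^{(p)}(u_m)`**: for an exact `[p]_W`-tower `v` of `Ŵ(𝔪_{ℂ_F})` with `‖vₙ − uₙᵖ‖ ≤ ‖p‖` (`u` any sequence) and `𝒞` the limit of
`pᵐ·Σ'[Xʲ]ℓ^{(p)}·u_mʲ`, one has `Σ'[Xʲ]log_W·v₀ʲ = 𝒞` (the Colmez functional of the `F_W`-HOMOMORPHISM `log_W` along `v` is the constant `log_W(v₀)`, and it can be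
computed along the `‖p‖`-close sequence `(uₘᵖ)` by transport invariance; `ℓ^{(p)}(u_m) = ℓ(u_mᵖ)`). [cite: Colmez1992PeriodesAbeliennes, §2]
[cite: Katz1981CrystallineDieudonne, §5.1, Thm. 5.1.4] -/
theorem tsum_formalLog_frobTwist_eq_of_tendsto [CharZero (CompletedAlgClosure F)] (u v : ℕ → (maxNilIdealC F).toIdeal)
    (hv : ∀ n, mulPC F p W (v (n + 1)) = v n)
    (hvu : ∀ n, ‖(((v n : (maxNilIdealC F).toIdeal) : CBall F) : CompletedAlgClosure F) -
      (((u n : (maxNilIdealC F).toIdeal) : CBall F) : CompletedAlgClosure F) ^ p‖ ≤ ‖(p : CompletedAlgClosure F)‖)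
    {𝒞 : CompletedAlgClosure F}
    (h𝒞 : Tendsto (fun m : ℕ => (p : CompletedAlgClosure F) ^ m *
      ∑' j : ℕ, PowerSeries.coeff j (PowerSeries.expand p (Fact.out : p.Prime).ne_zero (W.map (Int.castRingHom (CompletedAlgClosure F))).formalLog) *
        (((u m : (maxNilIdealC F).toIdeal) : CBall F) : CompletedAlgClosure F) ^ j) atTop (𝓝 𝒞)) :
    ∑' j : ℕ, PowerSeries.coeff j (W.map (Int.castRingHom (CompletedAlgClosure F))).formalLog *
        (((v 0 : (maxNilIdealC F).toIdeal) : CBall F) : CompletedAlgClosure F) ^ j = 𝒞 := by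
  have hpC : ‖(p : CompletedAlgClosure F)‖ < 1 := norm_natCast_C_lt_one'
  set ℓ := (W.map (Int.castRingHom (CompletedAlgClosure F))).formalLog with hℓ
  obtain ⟨k, hk⟩ := exists_nat_norm_coeff_formalLog_map_le_pow (K := CompletedAlgClosure F) W hpC
  -- the `‖p‖`-close sequence `sₘ = uₘᵖ` of points of `𝔪_{ℂ_F}`
  have hs1 : ∀ m, ‖(((u m : (maxNilIdealC F).toIdeal) : CBall F) : CompletedAlgClosure F) ^ p‖ < 1 := fun m => by
    rw [norm_pow]; exact pow_lt_one₀ (norm_nonneg _) (u m).2 (Fact.out : p.Prime).ne_zero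
  set s : ℕ → (maxNilIdealC F).toIdeal := fun m => mkBallPt ((((u m : (maxNilIdealC F).toIdeal) : CBall F) : CompletedAlgClosure F) ^ p) (hs1 m)
    with hs
  have hvs : ∀ n, ‖(((v n : (maxNilIdealC F).toIdeal) : CBall F) : CompletedAlgClosure F) -
      (((s n : (maxNilIdealC F).toIdeal) : CBall F) : CompletedAlgClosure F)‖ ≤ ‖(p : CompletedAlgClosure F)‖ := fun n => by
    rw [hs]; simp only [coe_coe_mkBallPt]; exact hvu n
  -- transport invariance for `ℓ` (cocycle `0`): `pᵐ ℓ(sₘ) → ℓ(v₀)`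
  have hconst : Tendsto (fun m : ℕ => (p : CompletedAlgClosure F) ^ m *
      ∑' j : ℕ, PowerSeries.coeff j ℓ * (((v m : (maxNilIdealC F).toIdeal) : CBall F) : CompletedAlgClosure F) ^ j) atTop
      (𝓝 (∑' j : ℕ, PowerSeries.coeff j ℓ * (((v 0 : (maxNilIdealC F).toIdeal) : CBall F) : CompletedAlgClosure F) ^ j)) :=
    tendsto_const_nhds.congr fun m => (pow_mul_tsum_formalLog_divisionSeq (K := CompletedAlgClosure F) W hpC v hv m).symm
  have hlim := tendsto_pow_mul_tsum_of_divisionSeq_norm_sub_le (K := CompletedAlgClosure F) W ℓ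
    (W.map (Int.castRingHom (CompletedAlgClosure F))).constantCoeff_formalLog k hk le_rfl (norm_coeff_formalLog_map_cocycle_le W) hpC hpC s v hv hvs
    hconst
  -- `ℓ(sₘ) = ℓ^{(p)}(uₘ)`
  have hls : ∀ m, ∑' j : ℕ, PowerSeries.coeff j ℓ * (((s m : (maxNilIdealC F).toIdeal) : CBall F) : CompletedAlgClosure F) ^ j =
      ∑' j : ℕ, PowerSeries.coeff j (PowerSeries.expand p (Fact.out : p.Prime).ne_zero ℓ) *
        (((u m : (maxNilIdealC F).toIdeal) : CBall F) : CompletedAlgClosure F) ^ j := fun m => by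
    rw [hs]; simp only [coe_coe_mkBallPt]; rw [tsum_coeff_expand_mul_pow]
  simp only [hls] at hlim
  exact tendsto_nhds_unique hlim h𝒞

/-! ## §3 `θ(f φΛ) = p^N·ℓ(v₀) = p^N·𝒞` -/

set_option maxHeartbeats 1600000 in
/-- ★★ **`θ_dR(f(φΛ_N(ι[ũ], z))) = p^N · log_W(v₀)`** for the Frobenius-twisted tower `v` of `u` (ANY exact `[p]_W`-tower with `‖vₙ − uₙᵖ‖ ≤ ‖p‖`):
`φΛ_N(ι[ũ], z) = Λ_N(ι φ[ũ], φ⁰z)` (`frobBmaxPlus_logSum_algebraMap`), `θ(f Λ_N(ι y₀, z')) = p^N·log_W(θ y₀)` at `y₀ = φ[ũ]` (T2a), `θ(φ[ũ]) = v₀`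
(`theta_frob_torsionLift_eq`). [cite: Colmez1992PeriodesAbeliennes, §2] [cite: Fontaine1982FormesDifferentielles, §5] -/
theorem thetaBdR_bmaxPlusToBdR_frobBmaxPlus_logSum_eq_pow_mul_tsum [CharZero (CompletedAlgClosure F)] (hp : valuation F p < 1) {N : ℕ} (hN : 1 ≤ N)
    {u : ℕ → (maxNilIdealC F).toIdeal} (hup : ∀ n, mulPC F p W (u (n + 1)) = u n) {z : bmaxZero F p}
    (hz : algebraMap (Ainf (p := p) F) (bmaxZero F p) ((of F p).symm (torsionLift W hθ u hup)) ^ N = (p : bmaxZero F p) * z)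
    (v : ℕ → (maxNilIdealC F).toIdeal) (hv : ∀ n, mulPC F p W (v (n + 1)) = v n)
    (hvu : ∀ n, ‖(((v n : (maxNilIdealC F).toIdeal) : CBall F) : CompletedAlgClosure F) -
      (((u n : (maxNilIdealC F).toIdeal) : CBall F) : CompletedAlgClosure F) ^ p‖ ≤ ‖(p : CompletedAlgClosure F)‖) :
    thetaBdR (bmaxPlusToBdR F p (frobBmaxPlus F p
      (PadicLogSeries.logSum ((algebraMap (Ainf (p := p) F) (bmaxZero F p)).comp zpToAinf) (GaloisContinuity.formalLogNum W p) N
        (algebraMap (Ainf (p := p) F) (bmaxZero F p) ((of F p).symm (torsionLift W hθ u hup))) z))) =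
      (p : CompletedAlgClosure F) ^ N *
        ∑' j : ℕ, PowerSeries.coeff j (W.map (Int.castRingHom (CompletedAlgClosure F))).formalLog *
          (((v 0 : (maxNilIdealC F).toIdeal) : CBall F) : CompletedAlgClosure F) ^ j := by
  set y₀ : Ainf (p := p) F := (of F p).symm (torsionLift W hθ u hup) with hy₀
  -- `φΛ = Λ(ι φy₀, φ⁰z)` with witness `(ι φy₀)^N = p·φ⁰z`
  have hz' : algebraMap (Ainf (p := p) F) (bmaxZero F p) (WittVector.frobenius y₀) ^ N = (p : bmaxZero F p) * frobBmaxZero F p z := by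
    have h := algebraMap_frobenius_pow_pow_eq N hz 1
    simpa only [pow_one] using h
  -- `θ(φ y₀) = v₀`
  have hθφ : thetaBdR (ainfToBdR (WittVector.frobenius y₀)) = (((v 0 : (maxNilIdealC F).toIdeal) : CBall F) : CompletedAlgClosure F) := by
    rw [thetaBdR_ainfToBdR, ← coe_theta, ← theta_frob_torsionLift_eq W (hθ := hθ) hup v hv hvu, hy₀]
  have hy : ‖thetaBdR (ainfToBdR (WittVector.frobenius y₀))‖ < 1 := by rw [hθφ]; exact (v 0).2
  rw [frobBmaxPlus_logSum_algebraMap, thetaBdR_bmaxPlusToBdR_logSum_eq_pow_mul_tsum W hp hN _ hy hz', hθφ]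

set_option maxHeartbeats 1600000 in
/-- ★★★ **`θ_dR(f(φΛ_N(ι[ũ], z))) = p^N · 𝒞_u(log_W(Xᵖ))`** (T2b): for an exact `[p]_W`-division tower `u` of `Ŵ(𝔪_{ℂ_F})` (any depth), its period
`Λ = Λ_N(ι[ũ], z)` and the Colmez functional `𝒞 = lim pᵐ·Σ'[Xʲ]ℓ^{(p)}·u_mʲ` of `ℓ^{(p)} = log_W(Xᵖ)` along `u` (exists by
`SecondKindColmezFunctionalHodgeLine.exists_colmez_expand_formalLog`): `θ_dR(f(φΛ)) = p^N·𝒞`. Together with T2a (`θ_dR(fΛ) = p^N·log_W(u₀)`) this evaluates `θ` on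
the `Fil¹`-combination of the transported crystalline pair. [cite: Colmez1992PeriodesAbeliennes, §2] [cite: Katz1981CrystallineDieudonne, Thm. 5.1.4] -/
theorem thetaBdR_bmaxPlusToBdR_frobBmaxPlus_logSum_eq_pow_mul_colmez [CharZero (CompletedAlgClosure F)] (hp : valuation F p < 1) {N : ℕ} (hN : 1 ≤ N)
    {u : ℕ → (maxNilIdealC F).toIdeal} (hup : ∀ n, mulPC F p W (u (n + 1)) = u n) {z : bmaxZero F p}
    (hz : algebraMap (Ainf (p := p) F) (bmaxZero F p) ((of F p).symm (torsionLift W hθ u hup)) ^ N = (p : bmaxZero F p) * z)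
    {𝒞 : CompletedAlgClosure F}
    (h𝒞 : Tendsto (fun m : ℕ => (p : CompletedAlgClosure F) ^ m *
      ∑' j : ℕ, PowerSeries.coeff j (PowerSeries.expand p (Fact.out : p.Prime).ne_zero (W.map (Int.castRingHom (CompletedAlgClosure F))).formalLog) *
        (((u m : (maxNilIdealC F).toIdeal) : CBall F) : CompletedAlgClosure F) ^ j) atTop (𝓝 𝒞)) :
    thetaBdR (bmaxPlusToBdR F p (frobBmaxPlus F p
      (PadicLogSeries.logSum ((algebraMap (Ainf (p := p) F) (bmaxZero F p)).comp zpToAinf) (GaloisContinuity.formalLogNum W p) N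
        (algebraMap (Ainf (p := p) F) (bmaxZero F p) ((of F p).symm (torsionLift W hθ u hup))) z))) =
      (p : CompletedAlgClosure F) ^ N * 𝒞 := by
  obtain ⟨v, hv, hvu, -⟩ := exists_frobTwist_divisionSeq W (hθ := hθ) hup
  rw [thetaBdR_bmaxPlusToBdR_frobBmaxPlus_logSum_eq_pow_mul_tsum W hp hN hup hz v hv hvu, tsum_formalLog_frobTwist_eq_of_tendsto W u v hv hvu h𝒞]

end AinfTop

end Literature.NumberTheory.PAdicHodge
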